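import Summits.ResolutionOfSingularities.ResolutionOfSingularities.Theorems.EquisingularLiftEquisingularLiftOrdinaryPointsGeneralPosition
import Mathlib.Algebra.Module.LinearMap.Polynomial
import Mathlib.LinearAlgebra.Matrix.NonsingularInverse
import HarnessLib

/-!
# [OURS] ★★★ ORDINARY MULTIPLE POINTS IN LINEARLY GENERAL POSITION — MATRIX FORM (the points are columns of an invertible matrix)
# (cruxes `EquisingularLift` stmt-…-15660: regular blow-up models; `EquisingularLiftNat(Three)` stmt-…-20038 / -20148: `ELNatAt`)

[OURS · leafhand-res-equisingularlift-7 g1, 2026-08-31; cell `pub/decomp-res`] AI-produced, weaker than expert review; NOT a statement of any manuscript;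
nothing here proves resolution of singularities in positive characteristic.  DEF-FREE helper; no `sorry`; standard axioms; ZERO named hypotheses.

The final, classification-free packaging of the ordinary-points family (✓ `MultiOrd.elNatAt_of_ordinaryPoints_at`, p824893): the marked points are the
columns `B_{·c}`, `c ∈ S`, of ONE invertible matrix `B ∈ GL_{m+3}(K)` normalised by `B_{cc} = 1` («linearly general position» = they extend to a basis), the
(ord) data are the TRANSLATED CHARTS of `F` itself at these points, and the Jacobian condition reads «every singular point of `V₊(F)` is proportional to a
marked column».  The linear substitutions are `x ↦ Bx`, `x ↦ B⁻¹x` (Mathlib `Matrix.toMvPolynomial`, `toMvPolynomial_mul`, `mul_nonsing_inv`).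

* ★★★ `MultiOrd.elNatAt_of_ordinaryPoints_matrix` — EL♮ (`ELNatAt`), any dimension / degree / characteristic `p` (`K = K̄`);
* ★★★ `StrataSplit.blowupModel_of_ordinaryPoints_matrix` — regular blow-up model (conclusion of the OPEN residual `stub_blowupModel_ge_five`), `K = K̄`.

E.g. every integral hypersurface whose singular points are `≤ m + 3` nodes in linearly general position.  Honest label: closes no registered stub.

References: [Hartshorne1977, I Thm. 5.1, I Ex. 5.8, II Example 7.1.1, II Ex. 7.12]; [StacksProject, Tags 07PF, 080A].
-/

set_option linter.dupNamespace false -- mandated namespace `Summit.<Summit>.<Problem>` of this single-conjunct summit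

noncomputable section

open CategoryTheory CategoryTheory.Limits AlgebraicGeometry TopologicalSpace
open MvPolynomial
open Literature.AlgebraicGeometry.Resolution
open Literature.AlgebraicGeometry.Motives Literature.AlgebraicGeometry.Motives.SmoothHypersurface
open Literature.AlgebraicGeometry.Motives.ProjectiveSpace

namespace Summit.ResolutionOfSingularities.ResolutionOfSingularities.Cruxes.EquisingularLiftNat.Sections

namespace MultiOrd

variable {K : Type} [Field K] {N : ℕ}

/-- `x ↦ B⁻¹x` then `x ↦ Bx` is the identity substitution (`B` invertible). [folklore] -/
theorem aeval_toMvPolynomial_inv_toMvPolynomial (B : Matrix (Fin (N + 1)) (Fin (N + 1)) K) (hB : IsUnit B.det) (i : Fin (N + 1)) :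
    aeval (B⁻¹).toMvPolynomial (B.toMvPolynomial i) = X i := by
  rw [MvPolynomial.aeval_eq_bind₁, ← Matrix.toMvPolynomial_mul, Matrix.mul_nonsing_inv B hB, Matrix.toMvPolynomial_one]

/-- `x ↦ Bx` then `x ↦ B⁻¹x` is the identity substitution (`B` invertible). [folklore] -/
theorem aeval_toMvPolynomial_toMvPolynomial_inv (B : Matrix (Fin (N + 1)) (Fin (N + 1)) K) (hB : IsUnit B.det) (i : Fin (N + 1)) :
    aeval B.toMvPolynomial ((B⁻¹).toMvPolynomial i) = X i := by
  rw [MvPolynomial.aeval_eq_bind₁, ← Matrix.toMvPolynomial_mul, Matrix.nonsing_inv_mul B hB, Matrix.toMvPolynomial_one]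

/-- The value of the `i`-th new coordinate `(Bx)_i` at the vertex `e_c` is `B_{ic}`. [folklore] -/
theorem eval_single_toMvPolynomial (B : Matrix (Fin (N + 1)) (Fin (N + 1)) K) (c i : Fin (N + 1)) :
    eval (Pi.single c 1 : Fin (N + 1) → K) (B.toMvPolynomial i) = B i c := by
  rw [Matrix.toMvPolynomial_eval_eq_apply, Matrix.mulVec_single_one]
  rfl

/-- **A point proportional to the marked column `B_{·c}` has all other `B⁻¹`-coordinates zero.** [folklore] -/
theorem eval_toMvPolynomial_inv_eq_zero (B : Matrix (Fin (N + 1)) (Fin (N + 1)) K) (hB : IsUnit B.det) (c : Fin (N + 1)) (s : K)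
    (i : Fin (N + 1)) (hi : i ≠ c) :
    eval (s • fun l => B l c) ((B⁻¹).toMvPolynomial i) = 0 := by
  have hcol : (fun l => B l c) = B.mulVec (Pi.single c 1 : Fin (N + 1) → K) := by
    rw [Matrix.mulVec_single_one]; rfl
  rw [Matrix.toMvPolynomial_eval_eq_apply, Matrix.mulVec_smul, hcol, Matrix.mulVec_mulVec, Matrix.nonsing_inv_mul B hB,
    Matrix.one_mulVec, Pi.smul_apply, Pi.single_eq_of_ne hi, smul_zero]

/-- ★★★ **EL♮ FOR HYPERSURFACES WHOSE SINGULAR POINTS ARE ORDINARY MULTIPLE POINTS IN LINEARLY GENERAL POSITION — matrix form.**  `K = K̄` of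
characteristic `p`; `ι : H ↪ ℙ^{m+2}_K`, `range ι = V₊(F)`, `F` a prime form; `B ∈ GL_{m+3}(K)`; `S` duplicate-free with `B_{cc} = 1` for `c ∈ S`; (ordF) for
`c ∈ S` the chart `F(x_c := 1)` translated to the point `P_c = [B_{·c}]` reads `Φ_c + Ψ_c`, `Φ_c` a NONSINGULAR form of degree `μ_c ≥ 1`, `Ψ_c ∈ (y)^{μ_c+1}`;
(jacF) every `b ≠ 0` with `F(b) = 0`, `∇F(b) = 0` is `s·B_{·c}` for some `c ∈ S`.  Then `Theorems.EquisingularLift.ELNatAt p K (m+2) H ι`.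
[OURS · L1 W4.5b] [cite: Hartshorne1977, I Thm. 5.1, II Example 7.1.1] [cite: StacksProject, Tag 080A] -/
theorem elNatAt_of_ordinaryPoints_matrix (p : ℕ) (hp : p.Prime) [CharP K p] [IsAlgClosed K] {m : ℕ}
    {H : Scheme.{0}} (ι : H ⟶ (projectiveSpace (m + 1 + 1) K).left) [IsClosedImmersion ι]
    (F : MvPolynomial (Fin (m + 1 + 1 + 1)) K) {d : ℕ} (hF : F.IsHomogeneous d) (hFp : Prime F)
    (hrange : letI := MvPolynomial.gradedAlgebra (σ := Fin (m + 1 + 1 + 1)) (R := K)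
      Set.range ι = {x : Proj (homogeneousSubmodule (Fin (m + 1 + 1 + 1)) K) | F ∈ x.asHomogeneousIdeal})
    (B : Matrix (Fin (m + 1 + 1 + 1)) (Fin (m + 1 + 1 + 1)) K) (hB : IsUnit B.det)
    (S : List (Fin (m + 2 + 1))) (hS : S.Nodup) (hB1 : ∀ c ∈ S, B c c = 1)
    (hordF : ∀ c ∈ S, ∃ (μ : ℕ) (Φ Ψ : MvPolynomial (Fin (m + 2)) K), 1 ≤ μ ∧ Φ.IsHomogeneous μ ∧ IsNonsingularForm K Φ ∧
      Ψ ∈ Ideal.span (Set.range (X : Fin (m + 2) → MvPolynomial (Fin (m + 2)) K)) ^ (μ + 1) ∧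
        aeval (fun j : Fin (m + 2) => (X j : MvPolynomial (Fin (m + 2)) K) + C (B (c.succAbove j) c)) (ProjectiveSpace.dehomogenize K c F) = Φ + Ψ)
    (hjacF : ∀ b : Fin (m + 2 + 1) → K, b ≠ 0 → eval b F = 0 → (∀ j, eval b (pderiv j F) = 0) →
      ∃ c ∈ S, ∃ s : K, b = s • fun l => B l c) :
    Theorems.EquisingularLift.ELNatAt p K (m + 1 + 1) H ι := by
  refine elNatAt_of_ordinaryPoints_at p hp ι F hF hFp hrange (B⁻¹).toMvPolynomial B.toMvPolynomial
    (Matrix.toMvPolynomial_isHomogeneous _) (Matrix.toMvPolynomial_isHomogeneous _)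
    (aeval_toMvPolynomial_inv_toMvPolynomial B hB) (aeval_toMvPolynomial_toMvPolynomial_inv B hB)
    S hS (fun c l => B l c) hB1 (fun c hc i => ?_) hordF (fun b hb h0 hd => ?_)
  · rw [eval_single_toMvPolynomial, eval_single_toMvPolynomial, hB1 c hc, one_mul]
  · obtain ⟨c, hc, s, rfl⟩ := hjacF b hb h0 hd
    exact ⟨c, hc, fun i hi => eval_toMvPolynomial_inv_eq_zero B hB c s i hi⟩

end MultiOrd

end Summit.ResolutionOfSingularities.ResolutionOfSingularities.Cruxes.EquisingularLiftNat.Sections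

namespace Summit.ResolutionOfSingularities.ResolutionOfSingularities.Cruxes.EquisingularLift.StrataSplit

open Summit.ResolutionOfSingularities.ResolutionOfSingularities.Cruxes.EquisingularLiftNat.Sections

/-- ★★★ **Regular blow-up models for hypersurfaces whose singular points are ordinary multiple points in linearly general position — matrix form**
(`K = K̄`, any characteristic / dimension / degree): hypotheses of ✓ `MultiOrd.elNatAt_of_ordinaryPoints_matrix`; conclusion = that of the OPEN residual
`stub_blowupModel_ge_five` at `H`. [cite: Hartshorne1977, I Thm. 5.1, II Example 7.1.1, II Ex. 7.12] -/
theorem blowupModel_of_ordinaryPoints_matrix {K : Type} [Field K] [IsAlgClosed K] {m : ℕ} {H : Scheme.{0}}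
    (ι : H ⟶ (projectiveSpace (m + 1 + 1) K).left) [IsClosedImmersion ι] [IsIntegral H]
    (F : MvPolynomial (Fin (m + 1 + 1 + 1)) K) {d : ℕ} (hF : F.IsHomogeneous d) (hFp : Prime F)
    (hrange : letI := MvPolynomial.gradedAlgebra (σ := Fin (m + 1 + 1 + 1)) (R := K)
      Set.range ι = {x : Proj (homogeneousSubmodule (Fin (m + 1 + 1 + 1)) K) | F ∈ x.asHomogeneousIdeal})
    (B : Matrix (Fin (m + 1 + 1 + 1)) (Fin (m + 1 + 1 + 1)) K) (hB : IsUnit B.det)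
    (S : List (Fin (m + 2 + 1))) (hS : S.Nodup) (hB1 : ∀ c ∈ S, B c c = 1)
    (hordF : ∀ c ∈ S, ∃ (μ : ℕ) (Φ Ψ : MvPolynomial (Fin (m + 2)) K), 1 ≤ μ ∧ Φ.IsHomogeneous μ ∧ IsNonsingularForm K Φ ∧
      Ψ ∈ Ideal.span (Set.range (X : Fin (m + 2) → MvPolynomial (Fin (m + 2)) K)) ^ (μ + 1) ∧
        aeval (fun j : Fin (m + 2) => (X j : MvPolynomial (Fin (m + 2)) K) + C (B (c.succAbove j) c)) (ProjectiveSpace.dehomogenize K c F) = Φ + Ψ)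
    (hjacF : ∀ b : Fin (m + 2 + 1) → K, b ≠ 0 → eval b F = 0 → (∀ j, eval b (pderiv j F) = 0) →
      ∃ c ∈ S, ∃ s : K, b = s • fun l => B l c) :
    ∃ 𝔞 : H.IdealSheafData, 𝔞 ≠ ⊥ ∧ ∀ (Z : Scheme.{0}) (π : Z ⟶ H), IsBlowup π 𝔞 → Scheme.IsRegular Z := by
  refine blowupModel_of_ordinaryPoints_at ι F hF hFp hrange (B⁻¹).toMvPolynomial B.toMvPolynomial
    (Matrix.toMvPolynomial_isHomogeneous _) (Matrix.toMvPolynomial_isHomogeneous _)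
    (MultiOrd.aeval_toMvPolynomial_inv_toMvPolynomial B hB) (MultiOrd.aeval_toMvPolynomial_toMvPolynomial_inv B hB)
    S hS (fun c l => B l c) hB1 (fun c hc i => ?_) hordF (fun b hb h0 hd => ?_)
  · rw [MultiOrd.eval_single_toMvPolynomial, MultiOrd.eval_single_toMvPolynomial, hB1 c hc, one_mul]
  · obtain ⟨c, hc, s, rfl⟩ := hjacF b hb h0 hd
    exact ⟨c, hc, fun i hi => MultiOrd.eval_toMvPolynomial_inv_eq_zero B hB c s i hi⟩

end Summit.ResolutionOfSingularities.ResolutionOfSingularities.Cruxes.EquisingularLift.StrataSplit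

end
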